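import Summits.QuantumFields.YangMills.Theses.RectangleDomination
import HarnessLib

/-!
# Route `RectangleDomination` (planner ym-r3-idea-2 g8, LINE 17 «rectangle domination»), assembly item (stmt-QuantumFields-23868) — BY NAME

`MinimiserStabilityRegPr → FluctuationComparisonRegPrIntL → RectangleTailL → ShallowRectangleDominationL → DeepWindowTailL →
HistoryTailOfRectanglesL → YM3TorusSU2`: the glue `HistoryTailOfRectanglesL` turns the rectangle tail, the shallow deterministic domination and
the shared deep-window residual into `UnitScaleTilt.HistoryTailL`, and the deciding theorem of route `UnitScaleTilt` combines it with the two R3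
cruxes (19200, 20520) into the rung-R3 leaf.  Proof = the route's own deciding λ-term (`closes`).

Width seat ym-line-sfw-p2-w3 g32 (cell ym-idea-1, R3 family; free hands).  HONEST FRAMING: R3 (`YM3TorusSU2`) is a RECORD rung of LADDER-YM;
the cruxes `RectangleTailL` (XL), `ShallowRectangleDominationL`, `DeepWindowTailL` (22892), the glue `HistoryTailOfRectanglesL`, 19200 and 20520
are OPEN; this is plumbing of a draft route; no summit is proved and the Yang–Mills mass gap is NOT proved.
-/

set_option autoImplicit false

namespace Summit.QuantumFields.YangMills.Theorems

/-- **`RectangleDomination.Assembly`** (item stmt-QuantumFields-23868) BY NAME: the six hypotheses compose to the leaf exactly as in the route's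
deciding theorem — `UnitScaleTilt.closes h200 h201 (hG hR hD hW)`. [folklore] -/
theorem rectangleDomination_assembly_proof :
    Summit.QuantumFields.YangMills.Theses.RectangleDomination.Assembly :=
  fun h200 h201 hR hD hW hG => Summit.QuantumFields.YangMills.Theses.UnitScaleTilt.closes h200 h201 (hG hR hD hW)

end Summit.QuantumFields.YangMills.Theorems
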